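import Summits.Ventures.PercRepro.Edgewise

/-!
# The lattice coupling of two weight vectors

For two arbitrary (incomparable) probability vectors `p, p'` let `m = p ⊓ p'` (pointwise minimum)
and `r = extraWeights m p`, `r' = extraWeights m p'` (`(p - m)/(1 - m)`, the independent extra
weight that lifts `m` to `p` by a join: `m + r - m·r = p`, `join_extraWeights`).  On the cube
`E ⊕ (E ⊕ E)` with the product weights `latWeights p p' = (m, (r, r'))` the four configurations

* `latMin ω = ω ∘ inl`, `latLeft ω = latMin ω ⊔ η`, `latRight ω = latMin ω ⊔ η'`,
  `latMax ω = latMin ω ⊔ η ⊔ η'` (`η, η'` the two inner blocks)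

have the laws `P_{p ⊓ p'}`, `P_p`, `P_{p'}`, `P_{p ⊔ p'}` (`prob_lat*_latWeights`; the top law uses
that at every edge one of `r e, r' e` vanishes), are monotone in `ω`, and satisfy
`latMin ≤ latLeft, latRight ≤ latMax` pointwise.  This is the coupling behind the lattice form
`Φ(p, p') = N(π(p), π(p')) + N(π(p ⊓ p'), π(p ⊔ p'))` of `C-005.md` (p1's Conjecture L): any
abstract statement about four nested monotone cell maps on one cube with one product law
specialises to the four partition laws `λ_{p⊓p'}, λ_p, λ_{p'}, λ_{p⊔p'}` of a graph.
-/

namespace PercRepro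

open Finset

variable {E : Type*}


/-- The extra weights `(p e - m e) / (1 - m e)` (`0` where `m e = 1`) lifting `m` to `p ≥ m` by
an independent join: `m + r - m·r = p`. -/
noncomputable def extraWeights (m p : E → ℝ) : E → ℝ :=
  fun e => if m e = 1 then 0 else (p e - m e) / (1 - m e)

/-- `m + r - m·r = p` for `r = extraWeights m p`, when `m ≤ p ≤ 1`. -/
theorem join_extraWeights {m p : E → ℝ} (hp : IsProb p) (h : m ≤ p) (e : E) :
    m e + extraWeights m p e - m e * extraWeights m p e = p e := by
  unfold extraWeights
  split_ifs with h1
  · have h2 := hp.le_one e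
    have h3 := h e
    rw [h1] at h3 ⊢
    linarith
  · have h2 : (1 : ℝ) - m e ≠ 0 := sub_ne_zero.2 (Ne.symm h1)
    field_simp
    ring

/-- The extra weight vanishes where `m e = p e`. -/
theorem extraWeights_eq_zero {m p : E → ℝ} {e : E} (h : m e = p e) : extraWeights m p e = 0 := by
  unfold extraWeights
  split_ifs with h1
  · rfl
  · rw [h, sub_self, zero_div]

/-- The extra weights are probabilities when `0 ≤ m ≤ p ≤ 1`. -/
theorem isProb_extraWeights {m p : E → ℝ} (hm : IsProb m) (hp : IsProb p) (h : m ≤ p) :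
    IsProb (extraWeights m p) := by
  intro e
  unfold extraWeights
  split_ifs with h1
  · exact ⟨le_rfl, zero_le_one⟩
  · have h2 : 0 < 1 - m e := sub_pos.2 (lt_of_le_of_ne (hm.le_one e) h1)
    exact ⟨div_nonneg (by linarith [h e]) h2.le, (div_le_one h2).2 (by linarith [hp.le_one e])⟩

/-- The pointwise minimum of two weight vectors is a probability vector. -/
theorem IsProb.inf {p p' : E → ℝ} (hp : IsProb p) (hp' : IsProb p') : IsProb (p ⊓ p') := fun e =>
  ⟨le_inf (hp.nonneg e) (hp'.nonneg e), inf_le_of_left_le (hp.le_one e)⟩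

/-- The base configuration of the lattice coupling on `E ⊕ (E ⊕ E)`: the outer block. -/
def latMin (ω : Config (E ⊕ (E ⊕ E))) : Config E := ω ∘ Sum.inl

/-- The left configuration of the lattice coupling: outer block joined with the first inner block. -/
def latLeft (ω : Config (E ⊕ (E ⊕ E))) : Config E :=
  joinHalves (Sum.elim (ω ∘ Sum.inl) (ω ∘ Sum.inr ∘ Sum.inl))

/-- The right configuration of the lattice coupling: outer block joined with the second inner
block. -/
def latRight (ω : Config (E ⊕ (E ⊕ E))) : Config E :=
  joinHalves (Sum.elim (ω ∘ Sum.inl) (ω ∘ Sum.inr ∘ Sum.inr))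

/-- The top configuration of the lattice coupling: the join of all three blocks. -/
def latMax (ω : Config (E ⊕ (E ⊕ E))) : Config E :=
  joinHalves (Sum.elim (ω ∘ Sum.inl) (joinHalves (ω ∘ Sum.inr)))

/-- `latMin ≤ latLeft`. -/
theorem latMin_le_latLeft (ω : Config (E ⊕ (E ⊕ E))) : latMin ω ≤ latLeft ω :=
  left_le_joinHalves (Sum.elim (ω ∘ Sum.inl) (ω ∘ Sum.inr ∘ Sum.inl))

/-- `latMin ≤ latRight`. -/
theorem latMin_le_latRight (ω : Config (E ⊕ (E ⊕ E))) : latMin ω ≤ latRight ω :=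
  left_le_joinHalves (Sum.elim (ω ∘ Sum.inl) (ω ∘ Sum.inr ∘ Sum.inr))

/-- `latLeft ≤ latMax`. -/
theorem latLeft_le_latMax (ω : Config (E ⊕ (E ⊕ E))) : latLeft ω ≤ latMax ω := by
  apply monotone_joinHalves
  intro x
  cases x with
  | inl e => exact le_rfl
  | inr e => exact left_le_joinHalves (ω ∘ Sum.inr) e

/-- `latRight ≤ latMax`. -/
theorem latRight_le_latMax (ω : Config (E ⊕ (E ⊕ E))) : latRight ω ≤ latMax ω := by
  apply monotone_joinHalves
  intro x
  cases x with
  | inl e => exact le_rfl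
  | inr e => exact right_le_joinHalves (ω ∘ Sum.inr) e

/-- `latMin` is monotone. -/
theorem monotone_latMin : Monotone (latMin (E := E)) := fun _ _ h e => h (Sum.inl e)

/-- `latLeft` is monotone. -/
theorem monotone_latLeft : Monotone (latLeft (E := E)) := by
  intro ω ω' h
  apply monotone_joinHalves
  intro x
  cases x with
  | inl e => exact h (Sum.inl e)
  | inr e => exact h (Sum.inr (Sum.inl e))

/-- `latRight` is monotone. -/
theorem monotone_latRight : Monotone (latRight (E := E)) := by
  intro ω ω' h
  apply monotone_joinHalves
  intro x
  cases x with
  | inl e => exact h (Sum.inl e)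
  | inr e => exact h (Sum.inr (Sum.inr e))

/-- `latMax` is monotone. -/
theorem monotone_latMax : Monotone (latMax (E := E)) := by
  intro ω ω' h
  apply monotone_joinHalves
  intro x
  cases x with
  | inl e => exact h (Sum.inl e)
  | inr e => exact monotone_joinHalves (fun x => h (Sum.inr x)) e

/-- The lattice-coupling weights of two probability vectors `p, p'`: base `p ⊓ p'`, extra weights
lifting it to `p` and to `p'`. -/
noncomputable def latWeights (p p' : E → ℝ) : E ⊕ (E ⊕ E) → ℝ :=
  Sum.elim (p ⊓ p') (Sum.elim (extraWeights (p ⊓ p') p) (extraWeights (p ⊓ p') p'))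

/-- The lattice-coupling weights are probabilities. -/
theorem isProb_latWeights {p p' : E → ℝ} (hp : IsProb p) (hp' : IsProb p') :
    IsProb (latWeights p p') :=
  isProb_sum_elim (hp.inf hp')
    (isProb_sum_elim (isProb_extraWeights (hp.inf hp') hp inf_le_left)
      (isProb_extraWeights (hp.inf hp') hp' inf_le_right))

variable [Fintype E] [DecidableEq E]

/-- Law of `latMin` under `(m, (r, r'))`: `P_m`. -/
theorem prob_latMin (m r r' : E → ℝ) (A : Set (Config E)) :
    prob (Sum.elim m (Sum.elim r r')) (latMin ⁻¹' A) = prob m A :=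
  prob_left m (Sum.elim r r') A

/-- Law of `latLeft` under `(m, (r, r'))`: `P_{m + r - m·r}`. -/
theorem prob_latLeft (m r r' : E → ℝ) (A : Set (Config E)) :
    prob (Sum.elim m (Sum.elim r r')) (latLeft ⁻¹' A) = prob (fun e => m e + r e - m e * r e) A := by
  have h1 : latLeft ⁻¹' A = {ω : Config (E ⊕ (E ⊕ E)) |
      Sum.elim (ω ∘ Sum.inl) (edgewise (fun a _ => a) (ω ∘ Sum.inr)) ∈ joinHalves ⁻¹' A} := rfl
  rw [h1, prob_sum_elim_edgewise_right, prob_joinHalves]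
  simp only [edgeLaw_fst]

/-- Law of `latRight` under `(m, (r, r'))`: `P_{m + r' - m·r'}`. -/
theorem prob_latRight (m r r' : E → ℝ) (A : Set (Config E)) :
    prob (Sum.elim m (Sum.elim r r')) (latRight ⁻¹' A) =
      prob (fun e => m e + r' e - m e * r' e) A := by
  have h1 : latRight ⁻¹' A = {ω : Config (E ⊕ (E ⊕ E)) |
      Sum.elim (ω ∘ Sum.inl) (edgewise (fun _ b => b) (ω ∘ Sum.inr)) ∈ joinHalves ⁻¹' A} := rfl
  rw [h1, prob_sum_elim_edgewise_right, prob_joinHalves]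
  simp only [edgeLaw_snd]

/-- Law of `latMax` under `(m, (r, r'))`: `P_{1 - (1-m)(1-r)(1-r')}`, written as the iterated join. -/
theorem prob_latMax (m r r' : E → ℝ) (A : Set (Config E)) :
    prob (Sum.elim m (Sum.elim r r')) (latMax ⁻¹' A) =
      prob (fun e => m e + (r e + r' e - r e * r' e) - m e * (r e + r' e - r e * r' e)) A := by
  have h1 : latMax ⁻¹' A = {ω : Config (E ⊕ (E ⊕ E)) |
      Sum.elim (ω ∘ Sum.inl) (edgewise (· || ·) (ω ∘ Sum.inr)) ∈ joinHalves ⁻¹' A} := rfl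
  rw [h1, prob_sum_elim_edgewise_right, prob_joinHalves]
  simp only [edgeLaw_or]


/-- **Lattice coupling, base law**: `latMin` has law `P_{p ⊓ p'}`. -/
theorem prob_latMin_latWeights (p p' : E → ℝ) (A : Set (Config E)) :
    prob (latWeights p p') (latMin ⁻¹' A) = prob (p ⊓ p') A :=
  prob_latMin _ _ _ A

/-- **Lattice coupling, left law**: `latLeft` has law `P_p`. -/
theorem prob_latLeft_latWeights {p : E → ℝ} (hp : IsProb p) (p' : E → ℝ) (A : Set (Config E)) :
    prob (latWeights p p') (latLeft ⁻¹' A) = prob p A := by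
  rw [latWeights, prob_latLeft]
  congr 1
  funext e
  exact join_extraWeights hp inf_le_left e

/-- **Lattice coupling, right law**: `latRight` has law `P_{p'}`. -/
theorem prob_latRight_latWeights (p : E → ℝ) {p' : E → ℝ} (hp' : IsProb p') (A : Set (Config E)) :
    prob (latWeights p p') (latRight ⁻¹' A) = prob p' A := by
  rw [latWeights, prob_latRight]
  congr 1
  funext e
  exact join_extraWeights hp' inf_le_right e

/-- **Lattice coupling, top law**: `latMax` has law `P_{p ⊔ p'}`. -/
theorem prob_latMax_latWeights {p p' : E → ℝ} (hp : IsProb p) (hp' : IsProb p')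
    (A : Set (Config E)) : prob (latWeights p p') (latMax ⁻¹' A) = prob (p ⊔ p') A := by
  rw [latWeights, prob_latMax]
  congr 1
  funext e
  have hl := join_extraWeights hp (inf_le_left (a := p) (b := p')) e
  have hr := join_extraWeights hp' (inf_le_right (a := p) (b := p')) e
  rcases le_total (p e) (p' e) with h | h
  · have hm : (p ⊓ p') e = p e := by
      rw [Pi.inf_apply]
      exact inf_eq_left.2 h
    have hM : (p ⊔ p') e = p' e := by
      rw [Pi.sup_apply]
      exact sup_eq_right.2 h
    rw [extraWeights_eq_zero hm, hM]
    linear_combination hr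
  · have hm : (p ⊓ p') e = p' e := by
      rw [Pi.inf_apply]
      exact inf_eq_right.2 h
    have hM : (p ⊔ p') e = p e := by
      rw [Pi.sup_apply]
      exact sup_eq_left.2 h
    rw [extraWeights_eq_zero hm, hM]
    linear_combination hl

end PercRepro
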